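/-
Origin: written from primary sources — R. Howe, *θ-series and invariant theory* (1979) §2–§3 (restriction of the oscillator
representation of the big pair of a see-saw to the partner pair is the tensor of the renormalised small ones); S. Kudla,
*Seesaw dual reductive pairs* (1984) §1; W. Fulton, J. Harris, *Representation Theory* (1991) Lecture 6 (`∧²` of a
two-dimensional representation is its determinant character). Adapted: no. This file reads the tree's determinant law for the
see-saw wedge (`UnitaryDualPairSeesawWedgeKType`, `WedgePairDeterminant`) inside the `K_∞`-isotypic subspaces
`UnitaryGroup.kappaIsotypic` of `UnitaryGroupArchIsotropy(Twist)`: along the maximal compact subgroup `K_∞` of `U(H)(L⁺ ⊗ ℝ)` the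
wedge test function lies in `𝒮^χ` for `χ = det` of the common `2 × 2` matrices (times the scalar twist, for a normalised
representation). Kernel only; no records.
-/
import Literature.NumberTheory.GelbartRogawski1991.UnitaryDualPairSeesawWedgeKType
import Literature.NumberTheory.Automorphic.UnitaryGroupArchIsotropyTwist
import HarnessLib

-- buildfix G11b-3 recipe (LEDGER B13-1/B13-3): elaborate sequentially so the trailing `attribute [implicit_reducible]`
-- block (reducibilityCoreExt is keyed to the async environment branch) is in force at `.olean` export.
set_option Elab.async false

/-!
# The see-saw wedge test function lies in the `K_∞`-isotypic subspace `𝒮^χ`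

`UnitaryDualPairSeesawWedgeKType.seesawWedge_mem_weightSpace` says: along ANY family `k ↦ (g_k, u₁(k), u₂(k))` under which two
pairs of small test vectors transform through the same matrices `m k` (under the renormalised small representations
`ω₁′ = seesawRep₁`, `ω₂′ = seesawRep₂`), the wedge `φ₁₀ ⊗ φ₂₁ − φ₁₁ ⊗ φ₂₀` is a weight vector of the big representation
`ω_ψ ∘ s_pair` for `k ↦ det (m k)`.  The `K`-type subspace of record of the Hodge–CM model (`𝒮^κ`, PerL v5 l. 341) is
`UnitaryGroup.kappaIsotypic ρ e χ = {Φ | ∀ k ∈ K_∞, ρ (e(k, 1_f), 1) Φ = χ k • Φ}` (`UnitaryGroupArchIsotropy`), the weight space of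
the family `k ↦ (e (k_∞, 1_f), 1)` indexed by the archimedean isotropy group `K_∞ = archIsotropy L H τ T hT` of the base point, read
through a currency conversion `e : U(H)(𝔸) →* A`; for a NORMALISED representation `ρ′ = c • ρ` the isotypic subspaces shift by the
character `c ∘ (e, 1)` (`UnitaryGroupArchIsotropyTwist.kappaIsotypic_smul_twist′`).  This file specialises the determinant law to
that family:

* §1 (any representation `ρ` of `A × G′`, any bilinear `t`): **`wedgePair_mem_kappaIsotypic`** — if `ρ (e(k,1_f), 1)` restricts ON
  THE NOSE to a pair of operator families `(A_k, B_k)` on `t`, both pairs transform through `m k`, and `det (m k) = χ k`, then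
  `wedgePair t a b ∈ kappaIsotypic ρ e χ`; **`wedgePair_mem_kappaIsotypic_twist`** — the same for `ρ′` with
  `ρ′ g v = c g • ρ g v`, under `det (m k) · c (e(k,1_f), 1) = χ′ k` [FultonHarris1991, Lecture 6];
* §2 (the see-saw data of record of `UnitaryDualPairSeesawWedgeKType` §1, `(12)` torus): **`seesawWedge_mem_kappaIsotypic`** —
  for the three compatible splittings `s, s₁, s₂` and any `e : U(H)(𝔸) →* U(J_V)(𝔸_F)`: if for every `k ∈ K_∞` the two pairs
  `φ₁, φ₂` of small test vectors transform under `ω₁′(e k, 1)`, `ω₂′(e k, 1)` through the same matrix `m k` with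
  `det (m k) = χ k`, then `φ₁₀ ⊗ φ₂₁ − φ₁₁ ⊗ φ₂₀ ∈ kappaIsotypic (ω_ψ ∘ s_pair) e χ` (restriction at `u₁ = u₂ = 1`:
  `pairRep_blockDiag_seesawTensor` and `s_W(1 ⊕ᶠ 1) = 1`) [Howe1979, §3; Kudla1984, §1]; and the normalised form
  **`seesawWedge_mem_kappaIsotypic_twist`** for `ρ′ = c • (ω_ψ ∘ s_pair)`.

Provenance / use (Hodge–CM model-construction cell, E binder `gen12`, junction (SS-K) «the wedge test function lies in `𝒮^κ`»
of the see-saw record `SeesawCore.wedge_mem`, PKG `HodgeCM/Model/Binders/Gen12CharMem.lean`): at the pins of record the W-block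
representation is the normalised `cmPairRepTwist hGR η` (= `c • pairRep … (splittingOf hGR)` pointwise,
`cmPairRepTwist_apply_eq_smul`), its `K`-type subspace is `cmKTypeTwist … = kappaIsotypic (cmPairRepTwist …) (cmKTypeHom …) χ′`
(`UnitaryDualPairThetaKernelCMTwistKType`, definitional), and the matrix hypotheses are the strictness of the two `K`-type
situations of the small pairs.  Nothing here is a claim of the manuscripts under adjudication.
-/

set_option autoImplicit false

noncomputable section

open scoped Matrix
open NumberField
open Literature.RepresentationTheory
open Literature.NumberTheory.Automorphic
open Literature.NumberTheory.Automorphic.UnitaryGroup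
open Literature.NumberTheory.Weil1964
open Literature.Geometry.ComplexHyperbolic

namespace Literature.NumberTheory.GelbartRogawski1991

namespace UnitaryDualPair

/-! ## §1 Wedges through a bilinear map inside `kappaIsotypic` -/

section Generic

variable {L : Type} [Field L] [NumberField L] [IsCMField L] {H : Matrix (Fin 3) (Fin 3) L}
  {τ : L →+* ℂ} {T : GL (Fin 3) ℂ} {hT : formCongr (starRingEnd ℂ) T (H.map τ) = BallModel.J}
variable {A G' S S₁ S₂ : Type*} [Monoid A] [Monoid G'] [AddCommGroup S] [Module ℂ S] [AddCommGroup S₁] [Module ℂ S₁]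
  [AddCommGroup S₂] [Module ℂ S₂]

/-- **The wedge of two pairs lies in the `χ`-isotypic subspace for `K_∞ × 1`.**  Let `ρ (e(k,1_f), 1)`, `k ∈ K_∞`, restrict on
the nose to a pair of operator families `(A_k, B_k)` on the values of a bilinear map `t`, let both pairs `a, b` transform through
the same matrix `m k`, and let `det (m k) = χ k`.  Then `wedgePair t a b ∈ kappaIsotypic ρ e χ` (`∧²` of a two-dimensional
representation is its determinant). [cite: FultonHarris1991, Lecture 6] -/
theorem wedgePair_mem_kappaIsotypic (ρ : Representation ℂ (A × G') S)
    (e : (adelicGroupData (↥(maximalRealSubfield L)) L (IsCMField.complexConj L) 3 H).Adelic →* A)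
    (χ : archIsotropy L H τ T hT →* ℂˣ) (t : S₁ →ₗ[ℂ] S₂ →ₗ[ℂ] S)
    (Aop : archIsotropy L H τ T hT → S₁ →ₗ[ℂ] S₁) (Bop : archIsotropy L H τ T hT → S₂ →ₗ[ℂ] S₂)
    (a : Fin 2 → S₁) (b : Fin 2 → S₂) (m : archIsotropy L H τ T hT → Matrix (Fin 2) (Fin 2) ℂ)
    (hres : ∀ (k : archIsotropy L H τ T hT) (x : S₁) (y : S₂),
      ρ (e (archIsotropyToAdelic L H τ T hT k), 1) (t x y) = t (Aop k x) (Bop k y))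
    (hA : ∀ (k : archIsotropy L H τ T hT) (i : Fin 2), Aop k (a i) = ∑ j, m k j i • a j)
    (hB : ∀ (k : archIsotropy L H τ T hT) (i : Fin 2), Bop k (b i) = ∑ j, m k j i • b j)
    (hdet : ∀ k : archIsotropy L H τ T hT, (m k).det = (χ k : ℂ)) :
    wedgePair t a b ∈ kappaIsotypic ρ e χ := by
  rw [mem_kappaIsotypic_iff]
  intro k
  rw [wedgePair_def, map_sub, hres, hres, ← hdet k]
  exact wedgePair_eq_det_smul t a (fun i => Aop k (a i)) b (fun i => Bop k (b i)) (m k) (hA k) (hB k)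

/-- **The same for a NORMALISED representation** `ρ′ g v = c g • ρ g v`: if `det (m k) · c (e(k,1_f), 1) = χ′ k` then
`wedgePair t a b ∈ kappaIsotypic ρ′ e χ′` (`kappaIsotypic_smul_twist′`: the `χ′`-isotypic subspace of `ρ′` is the
`χ′ / (c ∘ (e,1))`-isotypic subspace of `ρ`). [cite: FultonHarris1991, Lecture 6] -/
theorem wedgePair_mem_kappaIsotypic_twist (ρ ρ' : Representation ℂ (A × G') S) (c : A × G' →* ℂˣ)
    (hc : ∀ g v, ρ' g v = (c g : ℂ) • ρ g v)
    (e : (adelicGroupData (↥(maximalRealSubfield L)) L (IsCMField.complexConj L) 3 H).Adelic →* A)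
    (χ' : archIsotropy L H τ T hT →* ℂˣ) (t : S₁ →ₗ[ℂ] S₂ →ₗ[ℂ] S)
    (Aop : archIsotropy L H τ T hT → S₁ →ₗ[ℂ] S₁) (Bop : archIsotropy L H τ T hT → S₂ →ₗ[ℂ] S₂)
    (a : Fin 2 → S₁) (b : Fin 2 → S₂) (m : archIsotropy L H τ T hT → Matrix (Fin 2) (Fin 2) ℂ)
    (hres : ∀ (k : archIsotropy L H τ T hT) (x : S₁) (y : S₂),
      ρ (e (archIsotropyToAdelic L H τ T hT k), 1) (t x y) = t (Aop k x) (Bop k y))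
    (hA : ∀ (k : archIsotropy L H τ T hT) (i : Fin 2), Aop k (a i) = ∑ j, m k j i • a j)
    (hB : ∀ (k : archIsotropy L H τ T hT) (i : Fin 2), Bop k (b i) = ∑ j, m k j i • b j)
    (hdet : ∀ k : archIsotropy L H τ T hT,
      (m k).det * (c (e (archIsotropyToAdelic L H τ T hT k), 1) : ℂ) = (χ' k : ℂ)) :
    wedgePair t a b ∈ kappaIsotypic ρ' e χ' := by
  rw [kappaIsotypic_smul_twist' ρ ρ' c hc e χ']
  refine wedgePair_mem_kappaIsotypic ρ e _ t Aop Bop a b m hres hA hB fun k => ?_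
  rw [MonoidHom.div_apply, kappaTwistChar_apply, Units.val_div_eq_div_val, ← hdet k,
    mul_div_cancel_right₀ _ (Units.ne_zero _)]

end Generic

/-! ## §2 The see-saw data of record (`(12)` torus): the wedge test function lies in `𝒮^χ` -/

section Twelve

variable {L : Type} [Field L] [NumberField L] [IsCMField L] {H : Matrix (Fin 3) (Fin 3) L}
  {τ : L →+* ℂ} {T : GL (Fin 3) ℂ} {hT : formCongr (starRingEnd ℂ) T (H.map τ) = BallModel.J}
variable (F E : Type) [Field F] [NumberField F] [Field E] [NumberField E] [Algebra F E]
variable (c : E ≃ₐ[F] E) (N M₁ M₂ : ℕ) {n n₁ n₂ : ℕ}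
  (eW : Fin N × Fin (M₁ + M₂) ≃ Fin n) (e₁ : Fin N × Fin M₁ ≃ Fin n₁) (e₂ : Fin N × Fin M₂ ≃ Fin n₂)
variable (JV : Matrix (Fin N) (Fin N) E) (J₁ : Matrix (Fin M₁) (Fin M₁) E) (J₂ : Matrix (Fin M₂) (Fin M₂) E)
variable {TV : Matrix (Fin N) (Fin N) F} {T₁ : Matrix (Fin M₁) (Fin M₁) F} {T₂ : Matrix (Fin M₂) (Fin M₂) F}
variable [Algebra.IsQuadraticExtension F E] {δ : E} (hcδ : c δ = -δ) (hδ : δ ≠ 0) {d : F}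
  (hd : δ * δ = algebraMap F E d) (hV : TV.IsSymm) (h₁ : T₁.IsSymm) (h₂ : T₂.IsSymm) (hVd : IsUnit TV.det)
  (h₁d : IsUnit T₁.det) (h₂d : IsUnit T₂.det) (hWd : IsUnit (finSum M₁ M₂ T₁ T₂).det)
  (hJV : JV = TV.map (algebraMap F E)) (hJ₁ : J₁ = T₁.map (algebraMap F E)) (hJ₂ : J₂ = T₂.map (algebraMap F E))
  {s : adelicPair F E c N (M₁ + M₂) JV (finSum M₁ M₂ J₁ J₂) →*
    adelicMpCont F (Fin n) (adelicGram F eW TV (finSum M₁ M₂ T₁ T₂))}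
  {s₁ : adelicPair F E c N M₁ JV J₁ →* adelicMpCont F (Fin n₁) (adelicGram F e₁ TV T₁)}
  {s₂ : adelicPair F E c N M₂ JV J₂ →* adelicMpCont F (Fin n₂) (adelicGram F e₂ TV T₂)}
  (hs : (splittingDatum F E c N (M₁ + M₂) eW JV (finSum M₁ M₂ J₁ J₂) hcδ hδ hd hV (isSymm_finSum h₁ h₂) hVd hWd hJV
    (finSum_eq_map_finSum F E M₁ M₂ J₁ J₂ hJ₁ hJ₂)).IsCompatible s)
  (hs₁ : (splittingDatum F E c N M₁ e₁ JV J₁ hcδ hδ hd hV h₁ hVd h₁d hJV hJ₁).IsCompatible s₁)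
  (hs₂ : (splittingDatum F E c N M₂ e₂ JV J₂ hcδ hδ hd hV h₂ hVd h₂d hJV hJ₂).IsCompatible s₂)
variable (e : (adelicGroupData (↥(maximalRealSubfield L)) L (IsCMField.complexConj L) 3 H).Adelic →* adelic F E c N JV)

/-- **Operator-level see-saw restriction at `u₁ = u₂ = 1`** along `K_∞`: `ω_ψ(s_pair(e k, 1)) (Φ₁ ⊗ Φ₂) =
(ω₁′(e k, 1) Φ₁) ⊗ (ω₂′(e k, 1) Φ₂)` (`pairRep_blockDiag_seesawTensor` and `1 ⊕ᶠ 1 = 1`). [cite: Howe1979, §3] -/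
theorem pairRep_arch_one_seesawTensor (k : archIsotropy L H τ T hT) (Φ₁ : piSchwartzBruhat F (Fin N × Fin M₁))
    (Φ₂ : piSchwartzBruhat F (Fin N × Fin M₂)) :
    pairRep F E c N (M₁ + M₂) eW JV (finSum M₁ M₂ J₁ J₂) s (e (archIsotropyToAdelic L H τ T hT k), 1)
        (seesawTensor F N M₁ M₂ eW Φ₁ Φ₂) =
      seesawTensor F N M₁ M₂ eW
        (seesawRep₁ F E c N M₁ M₂ eW e₁ e₂ JV J₁ J₂ hcδ hδ hd hV h₁ h₂ hVd h₁d h₂d hWd hJV hJ₁ hJ₂ hs hs₁ hs₂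
          (e (archIsotropyToAdelic L H τ T hT k), 1) Φ₁)
        (seesawRep₂ F E c N M₁ M₂ eW e₁ e₂ JV J₁ J₂ hcδ hδ hd hV h₁ h₂ hVd h₁d h₂d hWd hJV hJ₁ hJ₂ hs hs₁ hs₂
          (e (archIsotropyToAdelic L H τ T hT k), 1) Φ₂) := by
  have h1 : (1 : adelic F E c (M₁ + M₂) (finSum M₁ M₂ J₁ J₂)) =
      adelicBlockDiag F E c M₁ M₂ J₁ J₂ ((1 : adelic F E c M₁ J₁), (1 : adelic F E c M₂ J₂)) :=
    (map_one (adelicBlockDiag F E c M₁ M₂ J₁ J₂)).symm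
  rw [h1]
  exact pairRep_blockDiag_seesawTensor F E c N M₁ M₂ eW e₁ e₂ JV J₁ J₂ hcδ hδ hd hV h₁ h₂ hVd h₁d h₂d hWd hJV hJ₁ hJ₂
    hs hs₁ hs₂ _ 1 1 Φ₁ Φ₂

/-- **The see-saw wedge test function lies in `𝒮^χ`.**  If for every `k ∈ K_∞` the two pairs of small test vectors transform
under `ω₁′(e k, 1)`, `ω₂′(e k, 1)` through the same matrix `m k` and `det (m k) = χ k`, then
`φ₁₀ ⊗ φ₂₁ − φ₁₁ ⊗ φ₂₀ ∈ kappaIsotypic (ω_ψ ∘ s_pair) e χ` (model case: the pairs are matched bases of the `K_∞`-type `𝔭₊` of the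
two theta one-forms, `χ = κ = ∧²𝔭₊ ⊠ 𝟏`, PerL v5 l. 341). [cite: Howe1979, §3] -/
theorem seesawWedge_mem_kappaIsotypic (χ : archIsotropy L H τ T hT →* ℂˣ)
    (φ₁ : Fin 2 → piSchwartzBruhat F (Fin N × Fin M₁)) (φ₂ : Fin 2 → piSchwartzBruhat F (Fin N × Fin M₂))
    (m : archIsotropy L H τ T hT → Matrix (Fin 2) (Fin 2) ℂ)
    (hA : ∀ (k : archIsotropy L H τ T hT) (i : Fin 2),
      seesawRep₁ F E c N M₁ M₂ eW e₁ e₂ JV J₁ J₂ hcδ hδ hd hV h₁ h₂ hVd h₁d h₂d hWd hJV hJ₁ hJ₂ hs hs₁ hs₂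
        (e (archIsotropyToAdelic L H τ T hT k), 1) (φ₁ i) = ∑ l, m k l i • φ₁ l)
    (hB : ∀ (k : archIsotropy L H τ T hT) (i : Fin 2),
      seesawRep₂ F E c N M₁ M₂ eW e₁ e₂ JV J₁ J₂ hcδ hδ hd hV h₁ h₂ hVd h₁d h₂d hWd hJV hJ₁ hJ₂ hs hs₁ hs₂
        (e (archIsotropyToAdelic L H τ T hT k), 1) (φ₂ i) = ∑ l, m k l i • φ₂ l)
    (hdet : ∀ k : archIsotropy L H τ T hT, (m k).det = (χ k : ℂ)) :
    wedgePair (seesawTensor F N M₁ M₂ eW) φ₁ φ₂ ∈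
      kappaIsotypic (pairRep F E c N (M₁ + M₂) eW JV (finSum M₁ M₂ J₁ J₂) s) e χ :=
  wedgePair_mem_kappaIsotypic _ e χ (seesawTensor F N M₁ M₂ eW)
    (fun k => seesawRep₁ F E c N M₁ M₂ eW e₁ e₂ JV J₁ J₂ hcδ hδ hd hV h₁ h₂ hVd h₁d h₂d hWd hJV hJ₁ hJ₂ hs hs₁ hs₂
      (e (archIsotropyToAdelic L H τ T hT k), 1))
    (fun k => seesawRep₂ F E c N M₁ M₂ eW e₁ e₂ JV J₁ J₂ hcδ hδ hd hV h₁ h₂ hVd h₁d h₂d hWd hJV hJ₁ hJ₂ hs hs₁ hs₂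
      (e (archIsotropyToAdelic L H τ T hT k), 1))
    φ₁ φ₂ m
    (fun k x y => pairRep_arch_one_seesawTensor F E c N M₁ M₂ eW e₁ e₂ JV J₁ J₂ hcδ hδ hd hV h₁ h₂ hVd h₁d h₂d hWd hJV
      hJ₁ hJ₂ hs hs₁ hs₂ e k x y)
    hA hB hdet

/-- **Normalised form**: for `ρ′ = η • (ω_ψ ∘ s_pair)` pointwise (`ρ′ g Φ = η g • ω_ψ(s_pair g) Φ`, e.g. the tree's
`cmPairRepTwist`), the wedge lies in `kappaIsotypic ρ′ e χ′` as soon as `det (m k) · η (e k, 1) = χ′ k` for all `k ∈ K_∞`.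
[cite: Howe1979, §3] -/
theorem seesawWedge_mem_kappaIsotypic_twist
    (ρ' : Representation ℂ (adelic F E c N JV × adelic F E c (M₁ + M₂) (finSum M₁ M₂ J₁ J₂)) (piSchwartzBruhat F (Fin n)))
    (η : adelic F E c N JV × adelic F E c (M₁ + M₂) (finSum M₁ M₂ J₁ J₂) →* ℂˣ)
    (hρ' : ∀ g Φ, ρ' g Φ = (η g : ℂ) • pairRep F E c N (M₁ + M₂) eW JV (finSum M₁ M₂ J₁ J₂) s g Φ)
    (χ' : archIsotropy L H τ T hT →* ℂˣ)
    (φ₁ : Fin 2 → piSchwartzBruhat F (Fin N × Fin M₁)) (φ₂ : Fin 2 → piSchwartzBruhat F (Fin N × Fin M₂))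
    (m : archIsotropy L H τ T hT → Matrix (Fin 2) (Fin 2) ℂ)
    (hA : ∀ (k : archIsotropy L H τ T hT) (i : Fin 2),
      seesawRep₁ F E c N M₁ M₂ eW e₁ e₂ JV J₁ J₂ hcδ hδ hd hV h₁ h₂ hVd h₁d h₂d hWd hJV hJ₁ hJ₂ hs hs₁ hs₂
        (e (archIsotropyToAdelic L H τ T hT k), 1) (φ₁ i) = ∑ l, m k l i • φ₁ l)
    (hB : ∀ (k : archIsotropy L H τ T hT) (i : Fin 2),
      seesawRep₂ F E c N M₁ M₂ eW e₁ e₂ JV J₁ J₂ hcδ hδ hd hV h₁ h₂ hVd h₁d h₂d hWd hJV hJ₁ hJ₂ hs hs₁ hs₂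
        (e (archIsotropyToAdelic L H τ T hT k), 1) (φ₂ i) = ∑ l, m k l i • φ₂ l)
    (hdet : ∀ k : archIsotropy L H τ T hT,
      (m k).det * (η (e (archIsotropyToAdelic L H τ T hT k), 1) : ℂ) = (χ' k : ℂ)) :
    wedgePair (seesawTensor F N M₁ M₂ eW) φ₁ φ₂ ∈ kappaIsotypic ρ' e χ' :=
  wedgePair_mem_kappaIsotypic_twist _ ρ' η hρ' e χ' (seesawTensor F N M₁ M₂ eW)
    (fun k => seesawRep₁ F E c N M₁ M₂ eW e₁ e₂ JV J₁ J₂ hcδ hδ hd hV h₁ h₂ hVd h₁d h₂d hWd hJV hJ₁ hJ₂ hs hs₁ hs₂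
      (e (archIsotropyToAdelic L H τ T hT k), 1))
    (fun k => seesawRep₂ F E c N M₁ M₂ eW e₁ e₂ JV J₁ J₂ hcδ hδ hd hV h₁ h₂ hVd h₁d h₂d hWd hJV hJ₁ hJ₂ hs hs₁ hs₂
      (e (archIsotropyToAdelic L H τ T hT k), 1))
    φ₁ φ₂ m
    (fun k x y => pairRep_arch_one_seesawTensor F E c N M₁ M₂ eW e₁ e₂ JV J₁ J₂ hcδ hδ hd hV h₁ h₂ hVd h₁d h₂d hWd hJV
      hJ₁ hJ₂ hs hs₁ hs₂ e k x y)
    hA hB hdet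

end Twelve

/-! ### Build-lane note (ops-buildfix G11b-3 recipe, LEDGER B13-1, 2026-08-21)
`lean -o` (the hub build lane, never `lean`/the gate check) runs Lean 4.32's library-suggestion indexers
(`Lean.LibrarySuggestions.SymbolFrequency` / `SineQuaNon`, from their `exportEntriesFn`) over the statement of
every local theorem that is not a denied premise; on this family's statements (very large dependent binder
telescopes through the theta-kernel / dual-pair data) that fold runs for tens of minutes to hours and the build
lane kills the job (incident G11b-3, run/shared/lean/ops/buildfix/G11b-3-DOSSIER.md). `isDeniedPremise` skips
`[implicit_reducible]` constants before any fold, and a reducibility status on a *theorem* is inert (Meta never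
unfolds `thmInfo`; the kernel ignores the attribute), so the public theorems of this file are tagged
`[implicit_reducible]` purely to keep them out of that index. Only other effect: they are not offered by
`+suggestions` premise selectors. No statement or proof is changed; superseded if the operator lands a
deny-list form (`HarnessLib.PremiseIndex`). -/
set_option allowUnsafeReducibility true in
attribute [implicit_reducible]
  wedgePair_mem_kappaIsotypic wedgePair_mem_kappaIsotypic_twist pairRep_arch_one_seesawTensor
  seesawWedge_mem_kappaIsotypic seesawWedge_mem_kappaIsotypic_twist

end UnitaryDualPair

end Literature.NumberTheory.GelbartRogawski1991

end
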